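import Summits.BirchSwinnertonDyer.BirchSwinnertonDyer.Theorems.ByReductionTypeAtTwoFineSelmerConjAAtTwoAdditivePotGoodNarrowRankCertificate316LayerTwoParity
import Summits.BirchSwinnertonDyer.BirchSwinnertonDyer.Theorems.ByReductionTypeAtTwoFineSelmerConjAAtTwoAdditivePotGoodNarrowRankCertificate316LayerTwoSignsA
import Summits.BirchSwinnertonDyer.BirchSwinnertonDyer.Theorems.ByReductionTypeAtTwoFineSelmerConjAAtTwoAdditivePotGoodNarrowRankCertificate316LayerTwoSignsB
import Summits.BirchSwinnertonDyer.BirchSwinnertonDyer.Theorems.ByReductionTypeAtTwoFineSelmerConjAAtTwoAdditivePotGoodNarrowRankCertificate316LayerTwoSignsC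
import Summits.BirchSwinnertonDyer.BirchSwinnertonDyer.Theorems.ByReductionTypeAtTwoFineSelmerConjAAtTwoAdditivePotGoodNarrowRankCertificate316LayerOneTotPos
import Literature.NumberTheory.NumberFields.TotPosUnitsModSqMonotone
import HarnessLib

/-!
# Route `ByReductionTypeAtTwo` (rung K4), crux C1″ `FineSelmerConjAAtTwoAdditivePotGood` (item stmt-BirchSwinnertonDyer-22615):
# THE NARROW RANK CERTIFICATE OF `261648q1` ONE LAYER UP: `[Cl⁺(A₂) : Cl⁺(A₂)²] = [Cl⁺(A₁) : Cl⁺(A₁)²] = 2` for `A₁ = ℚ(θ,√2)`, `A₂ = ℚ(θ,√(2+√2))`,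
# `θ³ − θ² − 4θ + 2 = 0` (`rank₂ Cl⁺ = 1` at BOTH layers — the letter EQUAL12 of eng-2's CERT-NARROW6 v1.1, now KERNEL)
# (a `--supports 22615` file; seat `bsd-2adic-k4-w1` GEN 11; assembles `…316LayerTwoParity`, `…316LayerTwoSignsA/B/C`, `…316LayerOneTotPos` and k4-w2's
# Edgar–Mollin–Peterson door `index_range_pow_two_narrowClassGroup_eq_of_bounds_of_le`, p750350)

HONEST FRAMING (cell `bsd-2adic`, D-0036/D-0054/D-0152): KERNEL theorems about two totally real number fields; no elliptic curve, no named fact, no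
`sorry`, no definition. Closes nothing at the `∀`-level; nothing booked; BSD is not proved by any of this.

THE CERTIFICATE.  `h(A₁)`, `h(A₂)` odd (`…316LayerOneDyadic`, `…316LayerTwoParity`); `#(U⁺/U²)(A₁) ≥ 2` (`u₊`, `…316LayerOneTotPos`); and ELEVEN units of
`𝓞 A₂ = ℤ[θ, ξ, p]` (`ξ = √2/θ`, `p = η/(1+ξ)`, `η = e = ζ₁₆ + ζ₁₆⁻¹`): `−1`, `1 + θξ`, `4 − θ² − ξ`, `−θ − ξ + 2θξ`, `θ − ξ + 2θξ`, `1 + η`, `1 + η³ − 3η`, `θ + p`,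
`1 + θ²ξ + θη`, `1 + (θ−1)η`, `θ + ξ + θξη` (found by the seat's exact unit search, verified here by their inverses in `ℤ[θ,ξ,p]`) whose `11 × 11` sign matrix at the
real places `(r_i, ±√(2±√2))` minus `(r₂, −√(2−√2))` is invertible over `𝔽₂` (`Matrix.mulᵣ` + `decide`; the signs are the field-generic lemmas
`signs_r*_d316`) ⟹ `#sign(U(A₂)) ≥ 2¹¹`; with `[A₂ : ℚ] = 12 = 1 + 11` the door gives BOTH indices `= 2`.

* `layer_two_unit_ids_d316` — the inverses (any commutative ring).
* **`index_range_pow_two_narrowClassGroup_adjoin_sup_layer_two_d316`** — `[Cl⁺(A₂):(Cl⁺(A₂))²] = [Cl⁺(A₁):(Cl⁺(A₁))²] ∧ [Cl⁺(A₁):(Cl⁺(A₁))²] = 2`.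

References: [EdgarMollinPeterson1986] Thm. 2.1; [FrohlichTaylor1990] Ch. V §1 (1.8)–(1.13); [Washington1997] §13.1; [Cohen1993] §4.1.3, §6.3.
-/

set_option autoImplicit false
-- sibling precedent: the directory name repeats the summit name
set_option linter.dupNamespace false

noncomputable section

open scoped Classical IntermediateField NumberField Polynomial

namespace Summit.BirchSwinnertonDyer.BirchSwinnertonDyer.Theorems.AddKatoTwo

open Polynomial IsDedekindDomain NumberField Field IntermediateField
  Literature.NumberTheory.EllipticCurves Literature.NumberTheory.EllipticCurves.ZpExtension
  Literature.NumberTheory.IwasawaTheory Literature.NumberTheory.NumberFields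
  Literature.NumberTheory.GaloisRepresentations Literature.Geometry.Kaehler.ComplexTorus

/-- **The inverses of the ten units `e₁ … e₁₀` of `ℤ[θ, ξ, p]`** (`θ³ − θ² − 4θ + 2 = 0`, `ξ² = 9 + θ − 2θ²`, `p² = 4 − 10θ + 4θ² − 5ξ + 13θξ − 5θ²ξ`),
in any commutative ring. [folklore] [cite: Cohen1993, §6.3] -/
theorem layer_two_unit_ids_d316 {R : Type*} [CommRing R] (bB xB pB : R) (Rb : bB ^ 3 - bB ^ 2 - 4 * bB + 2 = 0)
    (Rx : xB ^ 2 = 9 + bB - 2 * bB ^ 2) (Rp : pB ^ 2 = 4 - 10 * bB + 4 * bB ^ 2 - 5 * xB + 13 * bB * xB - 5 * bB ^ 2 * xB) :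
    (1 + bB * xB) * (-1 + bB * xB) = 1 ∧
    (4 - bB ^ 2 - xB) * (-xB + 2 * bB + 3 * bB * xB - bB ^ 2 - bB ^ 2 * xB) = 1 ∧
    (-bB - xB + 2 * bB * xB) * (-2 + xB - bB - bB * xB - bB ^ 2 * xB) = 1 ∧
    (bB - xB + 2 * bB * xB) * (2 + xB + bB - bB * xB - bB ^ 2 * xB) = 1 ∧
    (1 + pB * (1 + xB)) * (1 + 3 * pB - xB * pB + bB * pB - bB * xB + bB * xB * pB - bB ^ 2 * pB) = 1 ∧
    (1 + 3 * pB - xB * pB + bB * pB + bB * xB * pB - bB ^ 2 * pB) * (1 - pB - xB * pB + bB * xB) = 1 ∧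
    (bB + pB) * (30 - 64 * pB + 8 * xB + 4 * bB - 17 * xB * pB - 8 * bB * pB + bB * xB - 7 * bB ^ 2 - 2 * bB * xB * pB + 15 * bB ^ 2 * pB - 2 * bB ^ 2 * xB + 4 * bB ^ 2 * xB * pB) = 1 ∧
    (1 + bB * pB + bB * xB * pB + bB ^ 2 * xB) * (-7 - 28 * pB + 6 * xB - 4 * bB + 6 * xB * pB - bB * pB - 4 * bB * xB + 5 * bB * xB * pB + 8 * bB ^ 2 * pB - 4 * bB ^ 2 * xB + bB ^ 2 * xB * pB) = 1 ∧
    (1 - pB - xB * pB + bB * pB + bB * xB * pB) * (13 + 23 * pB + 2 * xB + 9 * xB * pB + 4 * bB * pB + 3 * bB * xB - 4 * bB ^ 2 - 5 * bB ^ 2 * pB + bB ^ 2 * xB - 3 * bB ^ 2 * xB * pB) = 1 ∧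
    (4 * pB + xB + bB + bB * pB + bB * xB * pB - bB ^ 2 * pB) * (2 - 2 * pB - xB - 5 * bB - 2 * xB * pB + 3 * bB * pB + 3 * bB * xB + 2 * bB ^ 2 + 5 * bB * xB * pB - bB ^ 2 * pB - bB ^ 2 * xB - 2 * bB ^ 2 * xB * pB) = 1 := by
  refine ⟨?_, ?_, ?_, ?_, ?_, ?_, ?_, ?_, ?_, ?_⟩
  · linear_combination ((-1 : R) + (-2 : R) * bB) * Rb + ((1 : R) * bB ^ 2) * Rx + ((0 : R)) * Rp
  · linear_combination ((4 : R) + (-2 : R) * xB + (-1 : R) * bB + (1 : R) * bB * xB) * Rb + ((1 : R) + (-3 : R) * bB + (1 : R) * bB ^ 2) * Rx + ((0 : R)) * Rp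
  · linear_combination ((13 : R) + (1 : R) * xB + (6 : R) * bB + (-2 : R) * xB ^ 2) * Rb + ((3 : R) + (-5 : R) * bB + (-3 : R) * bB ^ 2) * Rx + ((0 : R)) * Rp
  · linear_combination ((13 : R) + (-1 : R) * xB + (6 : R) * bB + (-2 : R) * xB ^ 2) * Rb + ((3 : R) + (-5 : R) * bB + (-3 : R) * bB ^ 2) * Rx + ((0 : R)) * Rp
  · linear_combination ((113 : R) + (2 : R) * pB + (9 : R) * xB + (-46 : R) * bB + (-2 : R) * pB ^ 2 + (-18 : R) * xB ^ 2 + (-4 : R) * bB * xB + (5 : R) * bB * xB ^ 2) * Rb + ((26 : R) + (-66 : R) * bB + (-1 : R) * pB ^ 2 + (-1 : R) * bB * pB + (23 : R) * bB ^ 2 + (1 : R) * bB * pB ^ 2) * Rx + ((-2 : R) + (2 : R) * xB + (1 : R) * bB + (2 : R) * bB * xB + (-1 : R) * bB ^ 2 * xB) * Rp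
  · linear_combination ((-113 : R) + (1 : R) * pB + (-9 : R) * xB + (46 : R) * bB + (2 : R) * pB ^ 2 + (-1 : R) * xB * pB + (18 : R) * xB ^ 2 + (-2 : R) * bB * pB + (4 : R) * bB * xB + (-5 : R) * bB * xB ^ 2) * Rb + ((-26 : R) + (66 : R) * bB + (1 : R) * pB ^ 2 + (-1 : R) * bB * pB + (-23 : R) * bB ^ 2 + (-1 : R) * bB * pB ^ 2 + (1 : R) * bB ^ 2 * pB) * Rx + ((2 : R) + (-2 : R) * xB + (-1 : R) * bB + (-2 : R) * bB * xB + (1 : R) * bB ^ 2 * xB) * Rp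
  · linear_combination ((-124 : R) + (15 : R) * pB + (126 : R) * xB + (58 : R) * bB + (4 : R) * xB * pB + (42 : R) * xB ^ 2 + (-59 : R) * bB * xB + (-20 : R) * bB * xB ^ 2) * Rb + ((1 : R) + (-3 : R) * bB + (1 : R) * bB ^ 2) * Rx + ((-64 : R) + (-17 : R) * xB + (-8 : R) * bB + (-2 : R) * bB * xB + (15 : R) * bB ^ 2 + (4 : R) * bB ^ 2 * xB) * Rp
  · linear_combination ((203 : R) + (-32 : R) * pB + (-78 : R) * xB + (78 : R) * bB + (-18 : R) * pB ^ 2 + (3 : R) * xB * pB + (26 : R) * xB ^ 2 + (-16 : R) * bB * pB + (47 : R) * bB * xB + (9 : R) * xB * pB ^ 2 + (2 : R) * xB ^ 2 * pB + (-12 : R) * bB * pB ^ 2 + (8 : R) * bB * xB * pB + (-69 : R) * bB * xB ^ 2 + (1 : R) * xB ^ 2 * pB ^ 2 + (1 : R) * bB * xB ^ 2 * pB) * Rb + ((38 : R) + (-4 : R) * pB + (-62 : R) * bB + (-2 : R) * pB ^ 2 + (12 : R) * bB * pB + (-37 : R) * bB ^ 2 + (10 : R) * bB * pB ^ 2 +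 (8 : R) * bB ^ 2 * pB + (6 : R) * bB ^ 2 * pB ^ 2) * Rx + ((18 : R) + (-18 : R) * xB + (12 : R) * bB + (14 : R) * bB * xB + (1 : R) * bB ^ 2 + (13 : R) * bB ^ 2 * xB) * Rp
  · linear_combination ((-206 : R) + (-13 : R) * pB + (99 : R) * xB + (92 : R) * bB + (1 : R) * pB ^ 2 + (-3 : R) * xB * pB + (52 : R) * xB ^ 2 + (-6 : R) * bB * pB + (-49 : R) * bB * xB + (-8 : R) * xB * pB ^ 2 + (1 : R) * xB ^ 2 * pB + (-20 : R) * bB * xB ^ 2 + (-3 : R) * xB ^ 2 * pB ^ 2) * Rb + ((-24 : R) + (-4 : R) * pB + (60 : R) * bB + (-3 : R) * pB ^ 2 + (3 : R) * bB * pB + (-20 : R) * bB ^ 2 + (-3 : R) * bB * pB ^ 2 + (3 : R) * bB ^ 2 * pB) * Rx + ((-52 : R) + (-16 : R) * xB + (-7 : R) * bB + (-4 : R) * bB * xB + (13 : R) * bB ^ 2 + (4 : R) * bB ^ 2 * xB) * Rp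
  · linear_combination ((-923 : R) + (4 : R) * pB + (9 : R) * xB + (386 : R) * bB + (14 : R) * pB ^ 2 + (-3 : R) * xB * pB + (92 : R) * xB ^ 2 + (-2 : R) * bB * pB + (-4 : R) * bB * xB + (-6 : R) * xB * pB ^ 2 + (-1 : R) * xB ^ 2 * pB + (-5 : R) * bB * pB ^ 2 + (1 : R) * bB * xB * pB + (-20 : R) * bB * xB ^ 2 + (-2 : R) * xB ^ 2 * pB ^ 2 + (2 : R) * bB * xB * pB ^ 2) * Rb + ((-205 : R) + (523 : R) * bB + (4 : R) * pB ^ 2 + (-185 : R) * bB ^ 2 + (-10 : R) * bB * pB ^ 2 + (3 : R) * bB ^ 2 * pB ^ 2) * Rx + ((4 : R) * xB + (-10 : R) * bB + (-12 : R) * bB * xB + (4 : R) * bB ^ 2 + (4 : R) * bB ^ 2 * xB) * Rp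

variable {θ : AlgebraicClosure ℚ}

set_option linter.unusedSimpArgs false in
set_option maxHeartbeats 6400000 in
set_option maxRecDepth 100000 in
/-- **`[Cl⁺(A₂) : Cl⁺(A₂)²] = [Cl⁺(A₁) : Cl⁺(A₁)²] = 2`** for `A₁ = ℚ(θ) ⊔ ℚ_1`, `A₂ = ℚ(θ) ⊔ ℚ_2`, `θ³ − θ² − 4θ + 2 = 0` — the narrow rank certificate of the
census row `261648q1` at the rung `m = 1` (`rank₂ Cl⁺ = 1` at both layers), KERNEL. [cite: EdgarMollinPeterson1986, Thm. 2.1, p. 34]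
[cite: FrohlichTaylor1990, Ch. V §1 (1.8)–(1.13), pp. 163–164] [cite: Washington1997, §13.1] -/
theorem index_range_pow_two_narrowClassGroup_adjoin_sup_layer_two_d316
    (hθ : aeval θ (Cubic.toPoly ⟨1, ((-1 : ℤ) : ℚ), ((-4 : ℤ) : ℚ), ((2 : ℤ) : ℚ)⟩) = 0) :
    haveI : FiniteDimensional ℚ ↥ℚ⟮θ⟯ :=
      IntermediateField.adjoin.finiteDimensional ⟨_, Cubic.monic_of_a_eq_one', by rwa [← aeval_def]⟩
    haveI : FiniteDimensional ℚ ↥((CyclotomicZp.zpExtension 2).layer 1) := (CyclotomicZp.zpExtension 2).finiteDimensional_layer_holds 1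
    haveI : FiniteDimensional ℚ ↥((CyclotomicZp.zpExtension 2).layer 2) := (CyclotomicZp.zpExtension 2).finiteDimensional_layer_holds 2
    haveI : NumberField ↥(ℚ⟮θ⟯ ⊔ (CyclotomicZp.zpExtension 2).layer 1) := NumberField.mk
    haveI : NumberField ↥(ℚ⟮θ⟯ ⊔ (CyclotomicZp.zpExtension 2).layer 2) := NumberField.mk
    (powMonoidHom (α := NarrowClassGroup ↥(ℚ⟮θ⟯ ⊔ (CyclotomicZp.zpExtension 2).layer 2)) 2).range.index = (powMonoidHom (α := NarrowClassGroup ↥(ℚ⟮θ⟯ ⊔ (CyclotomicZp.zpExtension 2).layer 1)) 2).range.index ∧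
      (powMonoidHom (α := NarrowClassGroup ↥(ℚ⟮θ⟯ ⊔ (CyclotomicZp.zpExtension 2).layer 1)) 2).range.index = 2 := by
  haveI : FiniteDimensional ℚ ↥ℚ⟮θ⟯ :=
    IntermediateField.adjoin.finiteDimensional ⟨_, Cubic.monic_of_a_eq_one', by rwa [← aeval_def]⟩
  haveI : FiniteDimensional ℚ ↥((CyclotomicZp.zpExtension 2).layer 1) := (CyclotomicZp.zpExtension 2).finiteDimensional_layer_holds 1
  haveI : FiniteDimensional ℚ ↥((CyclotomicZp.zpExtension 2).layer 2) := (CyclotomicZp.zpExtension 2).finiteDimensional_layer_holds 2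
  haveI : NumberField ↥ℚ⟮θ⟯ := NumberField.mk
  haveI : NumberField ↥(ℚ⟮θ⟯ ⊔ (CyclotomicZp.zpExtension 2).layer 1) := NumberField.mk
  haveI : NumberField ↥(ℚ⟮θ⟯ ⊔ (CyclotomicZp.zpExtension 2).layer 2) := NumberField.mk
  obtain ⟨hreal2, hfin2, h3⟩ := layer_two_basics_d316 hθ
  haveI := hreal2
  -- a root `e ∈ ℚ_2` of `Ψ₂`
  obtain ⟨e, he, -, he4⟩ := CyclotomicZp.exists_mem_layer_two_quartic_zpExtension
  have he0 : (fun x : AlgebraicClosure ℚ => x ^ 2 - 2)^[2] e = 0 := by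
    simp only [Function.iterate_succ, Function.iterate_zero, Function.comp_apply, id_eq]
    linear_combination he4
  have hK2 : ℚ⟮θ⟯ ≤ ℚ⟮θ⟯ ⊔ (CyclotomicZp.zpExtension 2).layer 2 := le_sup_left
  have h12 : ℚ⟮θ⟯ ⊔ (CyclotomicZp.zpExtension 2).layer 1 ≤ ℚ⟮θ⟯ ⊔ (CyclotomicZp.zpExtension 2).layer 2 :=
    sup_le_sup_left ((CyclotomicZp.zpExtension 2).layer_mono (by norm_num : 1 ≤ 2)) _
  have heA : e ∈ ℚ⟮θ⟯ ⊔ (CyclotomicZp.zpExtension 2).layer 2 := (le_sup_right : (CyclotomicZp.zpExtension 2).layer 2 ≤ _) he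
  set e'' : ↥(ℚ⟮θ⟯ ⊔ (CyclotomicZp.zpExtension 2).layer 2) := ⟨e, heA⟩ with he''def
  set θ'' : ↥(ℚ⟮θ⟯ ⊔ (CyclotomicZp.zpExtension 2).layer 2) := inclusion hK2 (AdjoinSimple.gen ℚ θ) with hθ''def
  -- located roots of the cubic and of `Ψ₂`
  obtain ⟨ρ₀, ρ₁, ρ₂, x₀, x₁, x₂, hρ₀, hρ₁, hρ₂, hl₀, hu₀, hl₁, hu₁, hl₂, hu₂⟩ := exists_three_ringHom_adjoin_d316 hθ
  obtain ⟨b, hbθ, hb⟩ := exists_ringOfIntegers_cubic_root (p := -1) (q := -4) (r := 2) hθ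
  have hgenrel : AdjoinSimple.gen ℚ θ ^ 3 - AdjoinSimple.gen ℚ θ ^ 2 - 4 * AdjoinSimple.gen ℚ θ + 2 = 0 := by
    have hbgen : algebraMap (𝓞 ↥ℚ⟮θ⟯) ↥ℚ⟮θ⟯ b = AdjoinSimple.gen ℚ θ := Subtype.ext hbθ
    have h := congrArg (algebraMap (𝓞 ↥ℚ⟮θ⟯) ↥ℚ⟮θ⟯) hb
    simp only [map_add, map_mul, map_pow, map_intCast, map_zero, hbgen] at h
    push_cast at h
    linear_combination h
  have hxrel : ∀ (ρ : ↥ℚ⟮θ⟯ →+* ℝ) (x : ℝ), ρ (AdjoinSimple.gen ℚ θ) = x → x ^ 3 - x ^ 2 - 4 * x + 2 = 0 := by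
    intro ρ x hx
    have h := congrArg ρ hgenrel
    simp only [map_add, map_sub, map_mul, map_pow, map_ofNat, map_zero, hx] at h; exact h
  have hx₀ := hxrel ρ₀ x₀ hρ₀
  have hx₁ := hxrel ρ₁ x₁ hρ₁
  have hx₂ := hxrel ρ₂ x₂ hρ₂
  have hs2sq : Real.sqrt 2 ^ 2 = 2 := Real.sq_sqrt (by norm_num)
  have hs2u : Real.sqrt 2 < 2 := (Real.sqrt_lt' (by norm_num)).mpr (by norm_num)
  have hZ1sq : Real.sqrt (2 + Real.sqrt 2) ^ 2 = 2 + Real.sqrt 2 := Real.sq_sqrt (by positivity)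
  have hZ2sq : Real.sqrt (2 - Real.sqrt 2) ^ 2 = 2 - Real.sqrt 2 := Real.sq_sqrt (by linarith)
  have hrZ1p : (fun x : ℝ => x ^ 2 - 2)^[2] (Real.sqrt (2 + Real.sqrt 2)) = 0 := by
    simp only [Function.iterate_succ, Function.iterate_zero, Function.comp_apply, id_eq]; rw [hZ1sq]; linear_combination hs2sq
  have hrZ1m : (fun x : ℝ => x ^ 2 - 2)^[2] (-Real.sqrt (2 + Real.sqrt 2)) = 0 := by
    simp only [Function.iterate_succ, Function.iterate_zero, Function.comp_apply, id_eq]; rw [neg_sq, hZ1sq]; linear_combination hs2sq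
  have hrZ2p : (fun x : ℝ => x ^ 2 - 2)^[2] (Real.sqrt (2 - Real.sqrt 2)) = 0 := by
    simp only [Function.iterate_succ, Function.iterate_zero, Function.comp_apply, id_eq]; rw [hZ2sq]; linear_combination hs2sq
  have hrZ2m : (fun x : ℝ => x ^ 2 - 2)^[2] (-Real.sqrt (2 - Real.sqrt 2)) = 0 := by
    simp only [Function.iterate_succ, Function.iterate_zero, Function.comp_apply, id_eq]; rw [neg_sq, hZ2sq]; linear_combination hs2sq
  -- the integers `b`, `ξ`, `p` and the units
  obtain ⟨bB, xB, pB, hbBv, -, -, h2ξ, h2p, RbB, RxB, RpB⟩ := layer_two_integers_d316 hθ he he0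
  have hbB : (bB : ↥(ℚ⟮θ⟯ ⊔ (CyclotomicZp.zpExtension 2).layer 2)) = θ'' := hbBv
  have hξB : (xB : ↥(ℚ⟮θ⟯ ⊔ (CyclotomicZp.zpExtension 2).layer 2)) = (e'' ^ 2 - 2) * (4 + θ'' - θ'' ^ 2) / 2 := by
    rw [eq_div_iff (two_ne_zero' ↥(ℚ⟮θ⟯ ⊔ (CyclotomicZp.zpExtension 2).layer 2)), mul_comm]; exact h2ξ
  have hpB : (pB : ↥(ℚ⟮θ⟯ ⊔ (CyclotomicZp.zpExtension 2).layer 2)) = e'' * ((θ'' ^ 2 - θ'') + (1 - θ'') * (e'' ^ 2 - 2)) / 2 := by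
    rw [eq_div_iff (two_ne_zero' ↥(ℚ⟮θ⟯ ⊔ (CyclotomicZp.zpExtension 2).layer 2)), mul_comm]; exact h2p
  have hbB' : algebraMap (𝓞 ↥(ℚ⟮θ⟯ ⊔ (CyclotomicZp.zpExtension 2).layer 2)) ↥(ℚ⟮θ⟯ ⊔ (CyclotomicZp.zpExtension 2).layer 2) bB = θ'' := hbB
  have hξB' : algebraMap (𝓞 ↥(ℚ⟮θ⟯ ⊔ (CyclotomicZp.zpExtension 2).layer 2)) ↥(ℚ⟮θ⟯ ⊔ (CyclotomicZp.zpExtension 2).layer 2) xB = (e'' ^ 2 - 2) * (4 + θ'' - θ'' ^ 2) / 2 := hξB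
  have hpB' : algebraMap (𝓞 ↥(ℚ⟮θ⟯ ⊔ (CyclotomicZp.zpExtension 2).layer 2)) ↥(ℚ⟮θ⟯ ⊔ (CyclotomicZp.zpExtension 2).layer 2) pB = e'' * ((θ'' ^ 2 - θ'') + (1 - θ'') * (e'' ^ 2 - 2)) / 2 := hpB
  obtain ⟨hid1, hid2, hid3, hid4, hid5, hid6, hid7, hid8, hid9, hid10⟩ := layer_two_unit_ids_d316 bB xB pB RbB RxB RpB
  set e₀ : (𝓞 ↥(ℚ⟮θ⟯ ⊔ (CyclotomicZp.zpExtension 2).layer 2))ˣ := -1 with he₀def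
  set e₁ : (𝓞 ↥(ℚ⟮θ⟯ ⊔ (CyclotomicZp.zpExtension 2).layer 2))ˣ := Units.mkOfMulEqOne _ _ hid1 with he₁def
  set e₂ : (𝓞 ↥(ℚ⟮θ⟯ ⊔ (CyclotomicZp.zpExtension 2).layer 2))ˣ := Units.mkOfMulEqOne _ _ hid2 with he₂def
  set e₃ : (𝓞 ↥(ℚ⟮θ⟯ ⊔ (CyclotomicZp.zpExtension 2).layer 2))ˣ := Units.mkOfMulEqOne _ _ hid3 with he₃def
  set e₄ : (𝓞 ↥(ℚ⟮θ⟯ ⊔ (CyclotomicZp.zpExtension 2).layer 2))ˣ := Units.mkOfMulEqOne _ _ hid4 with he₄def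
  set e₅ : (𝓞 ↥(ℚ⟮θ⟯ ⊔ (CyclotomicZp.zpExtension 2).layer 2))ˣ := Units.mkOfMulEqOne _ _ hid5 with he₅def
  set e₆ : (𝓞 ↥(ℚ⟮θ⟯ ⊔ (CyclotomicZp.zpExtension 2).layer 2))ˣ := Units.mkOfMulEqOne _ _ hid6 with he₆def
  set e₇ : (𝓞 ↥(ℚ⟮θ⟯ ⊔ (CyclotomicZp.zpExtension 2).layer 2))ˣ := Units.mkOfMulEqOne _ _ hid7 with he₇def
  set e₈ : (𝓞 ↥(ℚ⟮θ⟯ ⊔ (CyclotomicZp.zpExtension 2).layer 2))ˣ := Units.mkOfMulEqOne _ _ hid8 with he₈def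
  set e₉ : (𝓞 ↥(ℚ⟮θ⟯ ⊔ (CyclotomicZp.zpExtension 2).layer 2))ˣ := Units.mkOfMulEqOne _ _ hid9 with he₉def
  set e₁₀ : (𝓞 ↥(ℚ⟮θ⟯ ⊔ (CyclotomicZp.zpExtension 2).layer 2))ˣ := Units.mkOfMulEqOne _ _ hid10 with he₁₀def
  have hve₁ : ((e₁ : 𝓞 ↥(ℚ⟮θ⟯ ⊔ (CyclotomicZp.zpExtension 2).layer 2)) : ↥(ℚ⟮θ⟯ ⊔ (CyclotomicZp.zpExtension 2).layer 2)) = (1 + θ'' * ((e'' ^ 2 - 2) * (4 + θ'' - θ'' ^ 2) / 2)) := by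
    rw [he₁def, Units.val_mkOfMulEqOne, NumberField.RingOfIntegers.coe_eq_algebraMap]
    simp only [map_add, map_sub, map_mul, map_pow, map_neg, map_one, map_ofNat, hbB', hξB', hpB']
  have hve₂ : ((e₂ : 𝓞 ↥(ℚ⟮θ⟯ ⊔ (CyclotomicZp.zpExtension 2).layer 2)) : ↥(ℚ⟮θ⟯ ⊔ (CyclotomicZp.zpExtension 2).layer 2)) = (4 - θ'' ^ 2 - ((e'' ^ 2 - 2) * (4 + θ'' - θ'' ^ 2) / 2)) := by
    rw [he₂def, Units.val_mkOfMulEqOne, NumberField.RingOfIntegers.coe_eq_algebraMap]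
    simp only [map_add, map_sub, map_mul, map_pow, map_neg, map_one, map_ofNat, hbB', hξB', hpB']
  have hve₃ : ((e₃ : 𝓞 ↥(ℚ⟮θ⟯ ⊔ (CyclotomicZp.zpExtension 2).layer 2)) : ↥(ℚ⟮θ⟯ ⊔ (CyclotomicZp.zpExtension 2).layer 2)) = (-θ'' - ((e'' ^ 2 - 2) * (4 + θ'' - θ'' ^ 2) / 2) + 2 * θ'' * ((e'' ^ 2 - 2) * (4 + θ'' - θ'' ^ 2) / 2)) := by
    rw [he₃def, Units.val_mkOfMulEqOne, NumberField.RingOfIntegers.coe_eq_algebraMap]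
    simp only [map_add, map_sub, map_mul, map_pow, map_neg, map_one, map_ofNat, hbB', hξB', hpB']
  have hve₄ : ((e₄ : 𝓞 ↥(ℚ⟮θ⟯ ⊔ (CyclotomicZp.zpExtension 2).layer 2)) : ↥(ℚ⟮θ⟯ ⊔ (CyclotomicZp.zpExtension 2).layer 2)) = (θ'' - ((e'' ^ 2 - 2) * (4 + θ'' - θ'' ^ 2) / 2) + 2 * θ'' * ((e'' ^ 2 - 2) * (4 + θ'' - θ'' ^ 2) / 2)) := by
    rw [he₄def, Units.val_mkOfMulEqOne, NumberField.RingOfIntegers.coe_eq_algebraMap]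
    simp only [map_add, map_sub, map_mul, map_pow, map_neg, map_one, map_ofNat, hbB', hξB', hpB']
  have hve₅ : ((e₅ : 𝓞 ↥(ℚ⟮θ⟯ ⊔ (CyclotomicZp.zpExtension 2).layer 2)) : ↥(ℚ⟮θ⟯ ⊔ (CyclotomicZp.zpExtension 2).layer 2)) = (1 + (e'' * ((θ'' ^ 2 - θ'') + (1 - θ'') * (e'' ^ 2 - 2)) / 2) * (1 + ((e'' ^ 2 - 2) * (4 + θ'' - θ'' ^ 2) / 2))) := by
    rw [he₅def, Units.val_mkOfMulEqOne, NumberField.RingOfIntegers.coe_eq_algebraMap]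
    simp only [map_add, map_sub, map_mul, map_pow, map_neg, map_one, map_ofNat, hbB', hξB', hpB']
  have hve₆ : ((e₆ : 𝓞 ↥(ℚ⟮θ⟯ ⊔ (CyclotomicZp.zpExtension 2).layer 2)) : ↥(ℚ⟮θ⟯ ⊔ (CyclotomicZp.zpExtension 2).layer 2)) = (1 + 3 * (e'' * ((θ'' ^ 2 - θ'') + (1 - θ'') * (e'' ^ 2 - 2)) / 2) - ((e'' ^ 2 - 2) * (4 + θ'' - θ'' ^ 2) / 2) * (e'' * ((θ'' ^ 2 - θ'') + (1 - θ'') * (e'' ^ 2 - 2)) / 2) + θ'' * (e'' * ((θ'' ^ 2 - θ'') + (1 - θ'') * (e'' ^ 2 - 2)) / 2) + θ'' * ((e'' ^ 2 - 2) * (4 + θ'' - θ'' ^ 2) / 2) * (e'' * ((θ'' ^ 2 - θ'') + (1 - θ'') * (e'' ^ 2 - 2)) / 2) - θ'' ^ 2 * (e'' * ((θ'' ^ 2 - θ'') + (1 - θ'') * (e'' ^ 2 - 2)) / 2)) := by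
    rw [he₆def, Units.val_mkOfMulEqOne, NumberField.RingOfIntegers.coe_eq_algebraMap]
    simp only [map_add, map_sub, map_mul, map_pow, map_neg, map_one, map_ofNat, hbB', hξB', hpB']
  have hve₇ : ((e₇ : 𝓞 ↥(ℚ⟮θ⟯ ⊔ (CyclotomicZp.zpExtension 2).layer 2)) : ↥(ℚ⟮θ⟯ ⊔ (CyclotomicZp.zpExtension 2).layer 2)) = (θ'' + (e'' * ((θ'' ^ 2 - θ'') + (1 - θ'') * (e'' ^ 2 - 2)) / 2)) := by
    rw [he₇def, Units.val_mkOfMulEqOne, NumberField.RingOfIntegers.coe_eq_algebraMap]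
    simp only [map_add, map_sub, map_mul, map_pow, map_neg, map_one, map_ofNat, hbB', hξB', hpB']
  have hve₈ : ((e₈ : 𝓞 ↥(ℚ⟮θ⟯ ⊔ (CyclotomicZp.zpExtension 2).layer 2)) : ↥(ℚ⟮θ⟯ ⊔ (CyclotomicZp.zpExtension 2).layer 2)) = (1 + θ'' * (e'' * ((θ'' ^ 2 - θ'') + (1 - θ'') * (e'' ^ 2 - 2)) / 2) + θ'' * ((e'' ^ 2 - 2) * (4 + θ'' - θ'' ^ 2) / 2) * (e'' * ((θ'' ^ 2 - θ'') + (1 - θ'') * (e'' ^ 2 - 2)) / 2) + θ'' ^ 2 * ((e'' ^ 2 - 2) * (4 + θ'' - θ'' ^ 2) / 2)) := by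
    rw [he₈def, Units.val_mkOfMulEqOne, NumberField.RingOfIntegers.coe_eq_algebraMap]
    simp only [map_add, map_sub, map_mul, map_pow, map_neg, map_one, map_ofNat, hbB', hξB', hpB']
  have hve₉ : ((e₉ : 𝓞 ↥(ℚ⟮θ⟯ ⊔ (CyclotomicZp.zpExtension 2).layer 2)) : ↥(ℚ⟮θ⟯ ⊔ (CyclotomicZp.zpExtension 2).layer 2)) = (1 - (e'' * ((θ'' ^ 2 - θ'') + (1 - θ'') * (e'' ^ 2 - 2)) / 2) - ((e'' ^ 2 - 2) * (4 + θ'' - θ'' ^ 2) / 2) * (e'' * ((θ'' ^ 2 - θ'') + (1 - θ'') * (e'' ^ 2 - 2)) / 2) + θ'' * (e'' * ((θ'' ^ 2 - θ'') + (1 - θ'') * (e'' ^ 2 - 2)) / 2) + θ'' * ((e'' ^ 2 - 2) * (4 + θ'' - θ'' ^ 2) / 2) * (e'' * ((θ'' ^ 2 - θ'') + (1 - θ'') * (e'' ^ 2 - 2)) / 2)) := by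
    rw [he₉def, Units.val_mkOfMulEqOne, NumberField.RingOfIntegers.coe_eq_algebraMap]
    simp only [map_add, map_sub, map_mul, map_pow, map_neg, map_one, map_ofNat, hbB', hξB', hpB']
  have hve₁₀ : ((e₁₀ : 𝓞 ↥(ℚ⟮θ⟯ ⊔ (CyclotomicZp.zpExtension 2).layer 2)) : ↥(ℚ⟮θ⟯ ⊔ (CyclotomicZp.zpExtension 2).layer 2)) = (4 * (e'' * ((θ'' ^ 2 - θ'') + (1 - θ'') * (e'' ^ 2 - 2)) / 2) + ((e'' ^ 2 - 2) * (4 + θ'' - θ'' ^ 2) / 2) + θ'' + θ'' * (e'' * ((θ'' ^ 2 - θ'') + (1 - θ'') * (e'' ^ 2 - 2)) / 2) + θ'' * ((e'' ^ 2 - 2) * (4 + θ'' - θ'' ^ 2) / 2) * (e'' * ((θ'' ^ 2 - θ'') + (1 - θ'') * (e'' ^ 2 - 2)) / 2) - θ'' ^ 2 * (e'' * ((θ'' ^ 2 - θ'') + (1 - θ'') * (e'' ^ 2 - 2)) / 2)) := by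
    rw [he₁₀def, Units.val_mkOfMulEqOne, NumberField.RingOfIntegers.coe_eq_algebraMap]
    simp only [map_add, map_sub, map_mul, map_pow, map_neg, map_one, map_ofNat, hbB', hξB', hpB']
  have sneg : ∀ (σ : ↥(ℚ⟮θ⟯ ⊔ (CyclotomicZp.zpExtension 2).layer 2) →+* ℝ) (u : (𝓞 ↥(ℚ⟮θ⟯ ⊔ (CyclotomicZp.zpExtension 2).layer 2))ˣ), σ ((u : 𝓞 ↥(ℚ⟮θ⟯ ⊔ (CyclotomicZp.zpExtension 2).layer 2)) : ↥(ℚ⟮θ⟯ ⊔ (CyclotomicZp.zpExtension 2).layer 2)) < 0 → signVec u σ = 1 :=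
    fun σ u h => by rw [signVec_apply, if_pos h]
  have spos : ∀ (σ : ↥(ℚ⟮θ⟯ ⊔ (CyclotomicZp.zpExtension 2).layer 2) →+* ℝ) (u : (𝓞 ↥(ℚ⟮θ⟯ ⊔ (CyclotomicZp.zpExtension 2).layer 2))ˣ), 0 < σ ((u : 𝓞 ↥(ℚ⟮θ⟯ ⊔ (CyclotomicZp.zpExtension 2).layer 2)) : ↥(ℚ⟮θ⟯ ⊔ (CyclotomicZp.zpExtension 2).layer 2)) → signVec u σ = 0 :=
    fun σ u h => by rw [signVec_apply, if_neg (not_lt.mpr h.le)]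
  obtain ⟨τ01p, hτ01pK, hτ01pe⟩ := exists_ringHom_sup_layer_two_d316 hθ he he0 ρ₀ (Real.sqrt (2 + Real.sqrt 2)) hrZ1p
  have hτ01pθ : τ01p θ'' = x₀ := by rw [hθ''def, hτ01pK, hρ₀]
  obtain ⟨sτ01p1, sτ01p2, sτ01p3, sτ01p4, sτ01p5, sτ01p6, sτ01p7, sτ01p8, sτ01p9, sτ01p10⟩ := signs_r0_Z1pos_d316 τ01p θ'' e'' x₀ hτ01pθ hτ01pe (lt_of_eq_of_lt (by norm_num) hl₀) (lt_of_lt_of_eq hu₀ (by norm_num)) hx₀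
  obtain ⟨τ01m, hτ01mK, hτ01me⟩ := exists_ringHom_sup_layer_two_d316 hθ he he0 ρ₀ (-Real.sqrt (2 + Real.sqrt 2)) hrZ1m
  have hτ01mθ : τ01m θ'' = x₀ := by rw [hθ''def, hτ01mK, hρ₀]
  obtain ⟨sτ01m1, sτ01m2, sτ01m3, sτ01m4, sτ01m5, sτ01m6, sτ01m7, sτ01m8, sτ01m9, sτ01m10⟩ := signs_r0_Z1neg_d316 τ01m θ'' e'' x₀ hτ01mθ hτ01me (lt_of_eq_of_lt (by norm_num) hl₀) (lt_of_lt_of_eq hu₀ (by norm_num)) hx₀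
  obtain ⟨τ02p, hτ02pK, hτ02pe⟩ := exists_ringHom_sup_layer_two_d316 hθ he he0 ρ₀ (Real.sqrt (2 - Real.sqrt 2)) hrZ2p
  have hτ02pθ : τ02p θ'' = x₀ := by rw [hθ''def, hτ02pK, hρ₀]
  obtain ⟨sτ02p1, sτ02p2, sτ02p3, sτ02p4, sτ02p5, sτ02p6, sτ02p7, sτ02p8, sτ02p9, sτ02p10⟩ := signs_r0_Z2pos_d316 τ02p θ'' e'' x₀ hτ02pθ hτ02pe (lt_of_eq_of_lt (by norm_num) hl₀) (lt_of_lt_of_eq hu₀ (by norm_num)) hx₀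
  obtain ⟨τ02m, hτ02mK, hτ02me⟩ := exists_ringHom_sup_layer_two_d316 hθ he he0 ρ₀ (-Real.sqrt (2 - Real.sqrt 2)) hrZ2m
  have hτ02mθ : τ02m θ'' = x₀ := by rw [hθ''def, hτ02mK, hρ₀]
  obtain ⟨sτ02m1, sτ02m2, sτ02m3, sτ02m4, sτ02m5, sτ02m6, sτ02m7, sτ02m8, sτ02m9, sτ02m10⟩ := signs_r0_Z2neg_d316 τ02m θ'' e'' x₀ hτ02mθ hτ02me (lt_of_eq_of_lt (by norm_num) hl₀) (lt_of_lt_of_eq hu₀ (by norm_num)) hx₀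
  obtain ⟨τ11p, hτ11pK, hτ11pe⟩ := exists_ringHom_sup_layer_two_d316 hθ he he0 ρ₁ (Real.sqrt (2 + Real.sqrt 2)) hrZ1p
  have hτ11pθ : τ11p θ'' = x₁ := by rw [hθ''def, hτ11pK, hρ₁]
  obtain ⟨sτ11p1, sτ11p2, sτ11p3, sτ11p4, sτ11p5, sτ11p6, sτ11p7, sτ11p8, sτ11p9, sτ11p10⟩ := signs_r1_Z1pos_d316 τ11p θ'' e'' x₁ hτ11pθ hτ11pe (lt_of_eq_of_lt (by norm_num) hl₁) (lt_of_lt_of_eq hu₁ (by norm_num)) hx₁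
  obtain ⟨τ11m, hτ11mK, hτ11me⟩ := exists_ringHom_sup_layer_two_d316 hθ he he0 ρ₁ (-Real.sqrt (2 + Real.sqrt 2)) hrZ1m
  have hτ11mθ : τ11m θ'' = x₁ := by rw [hθ''def, hτ11mK, hρ₁]
  obtain ⟨sτ11m1, sτ11m2, sτ11m3, sτ11m4, sτ11m5, sτ11m6, sτ11m7, sτ11m8, sτ11m9, sτ11m10⟩ := signs_r1_Z1neg_d316 τ11m θ'' e'' x₁ hτ11mθ hτ11me (lt_of_eq_of_lt (by norm_num) hl₁) (lt_of_lt_of_eq hu₁ (by norm_num)) hx₁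
  obtain ⟨τ12p, hτ12pK, hτ12pe⟩ := exists_ringHom_sup_layer_two_d316 hθ he he0 ρ₁ (Real.sqrt (2 - Real.sqrt 2)) hrZ2p
  have hτ12pθ : τ12p θ'' = x₁ := by rw [hθ''def, hτ12pK, hρ₁]
  obtain ⟨sτ12p1, sτ12p2, sτ12p3, sτ12p4, sτ12p5, sτ12p6, sτ12p7, sτ12p8, sτ12p9, sτ12p10⟩ := signs_r1_Z2pos_d316 τ12p θ'' e'' x₁ hτ12pθ hτ12pe (lt_of_eq_of_lt (by norm_num) hl₁) (lt_of_lt_of_eq hu₁ (by norm_num)) hx₁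
  obtain ⟨τ12m, hτ12mK, hτ12me⟩ := exists_ringHom_sup_layer_two_d316 hθ he he0 ρ₁ (-Real.sqrt (2 - Real.sqrt 2)) hrZ2m
  have hτ12mθ : τ12m θ'' = x₁ := by rw [hθ''def, hτ12mK, hρ₁]
  obtain ⟨sτ12m1, sτ12m2, sτ12m3, sτ12m4, sτ12m5, sτ12m6, sτ12m7, sτ12m8, sτ12m9, sτ12m10⟩ := signs_r1_Z2neg_d316 τ12m θ'' e'' x₁ hτ12mθ hτ12me (lt_of_eq_of_lt (by norm_num) hl₁) (lt_of_lt_of_eq hu₁ (by norm_num)) hx₁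
  obtain ⟨τ21p, hτ21pK, hτ21pe⟩ := exists_ringHom_sup_layer_two_d316 hθ he he0 ρ₂ (Real.sqrt (2 + Real.sqrt 2)) hrZ1p
  have hτ21pθ : τ21p θ'' = x₂ := by rw [hθ''def, hτ21pK, hρ₂]
  obtain ⟨sτ21p1, sτ21p2, sτ21p3, sτ21p4, sτ21p5, sτ21p6, sτ21p7, sτ21p8, sτ21p9, sτ21p10⟩ := signs_r2_Z1pos_d316 τ21p θ'' e'' x₂ hτ21pθ hτ21pe (lt_of_eq_of_lt (by norm_num) hl₂) (lt_of_lt_of_eq hu₂ (by norm_num)) hx₂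
  obtain ⟨τ21m, hτ21mK, hτ21me⟩ := exists_ringHom_sup_layer_two_d316 hθ he he0 ρ₂ (-Real.sqrt (2 + Real.sqrt 2)) hrZ1m
  have hτ21mθ : τ21m θ'' = x₂ := by rw [hθ''def, hτ21mK, hρ₂]
  obtain ⟨sτ21m1, sτ21m2, sτ21m3, sτ21m4, sτ21m5, sτ21m6, sτ21m7, sτ21m8, sτ21m9, sτ21m10⟩ := signs_r2_Z1neg_d316 τ21m θ'' e'' x₂ hτ21mθ hτ21me (lt_of_eq_of_lt (by norm_num) hl₂) (lt_of_lt_of_eq hu₂ (by norm_num)) hx₂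
  obtain ⟨τ22p, hτ22pK, hτ22pe⟩ := exists_ringHom_sup_layer_two_d316 hθ he he0 ρ₂ (Real.sqrt (2 - Real.sqrt 2)) hrZ2p
  have hτ22pθ : τ22p θ'' = x₂ := by rw [hθ''def, hτ22pK, hρ₂]
  obtain ⟨sτ22p1, sτ22p2, sτ22p3, sτ22p4, sτ22p5, sτ22p6, sτ22p7, sτ22p8, sτ22p9, sτ22p10⟩ := signs_r2_Z2pos_d316 τ22p θ'' e'' x₂ hτ22pθ hτ22pe (lt_of_eq_of_lt (by norm_num) hl₂) (lt_of_lt_of_eq hu₂ (by norm_num)) hx₂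
  clear_value e₀ e₁ e₂ e₃ e₄ e₅ e₆ e₇ e₈ e₉ e₁₀
  have hs : ∀ i j, signVec (![e₀, e₁, e₂, e₃, e₄, e₅, e₆, e₇, e₈, e₉, e₁₀] i) (![τ01p, τ01m, τ02p, τ02m, τ11p, τ11m, τ12p, τ12m, τ21p, τ21m, τ22p] j) = !![(1 : ZMod 2), 1, 1, 1, 1, 1, 1, 1, 1, 1, 1; 0, 0, 1, 1, 0, 0, 1, 1, 0, 0, 1; 0, 0, 1, 1, 0, 0, 0, 0, 1, 1, 1; 0, 0, 1, 1, 1, 1, 1, 1, 1, 1, 1; 0, 0, 1, 1, 0, 0, 0, 0, 0, 0, 0; 0, 1, 0, 0, 0, 1, 0, 0, 0, 1, 0; 0, 0, 1, 0, 0, 0, 1, 0, 0, 0, 1; 0, 1, 1, 1, 0, 0, 0, 0, 0, 0, 0; 1, 0, 0, 0, 0, 0, 0, 1, 0, 1, 1; 1, 0, 1, 0, 0, 0, 0, 0, 0, 1, 0; 0, 1, 1, 0, 0, 0, 1, 1, 0, 0, 0] i j := by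
    intro i j
    fin_cases i <;> fin_cases j
    · show signVec e₀ τ01p = 1; rw [he₀def, signVec_neg_one]
    · show signVec e₀ τ01m = 1; rw [he₀def, signVec_neg_one]
    · show signVec e₀ τ02p = 1; rw [he₀def, signVec_neg_one]
    · show signVec e₀ τ02m = 1; rw [he₀def, signVec_neg_one]
    · show signVec e₀ τ11p = 1; rw [he₀def, signVec_neg_one]
    · show signVec e₀ τ11m = 1; rw [he₀def, signVec_neg_one]
    · show signVec e₀ τ12p = 1; rw [he₀def, signVec_neg_one]
    · show signVec e₀ τ12m = 1; rw [he₀def, signVec_neg_one]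
    · show signVec e₀ τ21p = 1; rw [he₀def, signVec_neg_one]
    · show signVec e₀ τ21m = 1; rw [he₀def, signVec_neg_one]
    · show signVec e₀ τ22p = 1; rw [he₀def, signVec_neg_one]
    · show signVec e₁ τ01p = 0; exact spos τ01p e₁ (by rw [hve₁]; exact sτ01p1)
    · show signVec e₁ τ01m = 0; exact spos τ01m e₁ (by rw [hve₁]; exact sτ01m1)
    · show signVec e₁ τ02p = 1; exact sneg τ02p e₁ (by rw [hve₁]; exact sτ02p1)
    · show signVec e₁ τ02m = 1; exact sneg τ02m e₁ (by rw [hve₁]; exact sτ02m1)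
    · show signVec e₁ τ11p = 0; exact spos τ11p e₁ (by rw [hve₁]; exact sτ11p1)
    · show signVec e₁ τ11m = 0; exact spos τ11m e₁ (by rw [hve₁]; exact sτ11m1)
    · show signVec e₁ τ12p = 1; exact sneg τ12p e₁ (by rw [hve₁]; exact sτ12p1)
    · show signVec e₁ τ12m = 1; exact sneg τ12m e₁ (by rw [hve₁]; exact sτ12m1)
    · show signVec e₁ τ21p = 0; exact spos τ21p e₁ (by rw [hve₁]; exact sτ21p1)
    · show signVec e₁ τ21m = 0; exact spos τ21m e₁ (by rw [hve₁]; exact sτ21m1)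
    · show signVec e₁ τ22p = 1; exact sneg τ22p e₁ (by rw [hve₁]; exact sτ22p1)
    · show signVec e₂ τ01p = 0; exact spos τ01p e₂ (by rw [hve₂]; exact sτ01p2)
    · show signVec e₂ τ01m = 0; exact spos τ01m e₂ (by rw [hve₂]; exact sτ01m2)
    · show signVec e₂ τ02p = 1; exact sneg τ02p e₂ (by rw [hve₂]; exact sτ02p2)
    · show signVec e₂ τ02m = 1; exact sneg τ02m e₂ (by rw [hve₂]; exact sτ02m2)
    · show signVec e₂ τ11p = 0; exact spos τ11p e₂ (by rw [hve₂]; exact sτ11p2)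
    · show signVec e₂ τ11m = 0; exact spos τ11m e₂ (by rw [hve₂]; exact sτ11m2)
    · show signVec e₂ τ12p = 0; exact spos τ12p e₂ (by rw [hve₂]; exact sτ12p2)
    · show signVec e₂ τ12m = 0; exact spos τ12m e₂ (by rw [hve₂]; exact sτ12m2)
    · show signVec e₂ τ21p = 1; exact sneg τ21p e₂ (by rw [hve₂]; exact sτ21p2)
    · show signVec e₂ τ21m = 1; exact sneg τ21m e₂ (by rw [hve₂]; exact sτ21m2)
    · show signVec e₂ τ22p = 1; exact sneg τ22p e₂ (by rw [hve₂]; exact sτ22p2)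
    · show signVec e₃ τ01p = 0; exact spos τ01p e₃ (by rw [hve₃]; exact sτ01p3)
    · show signVec e₃ τ01m = 0; exact spos τ01m e₃ (by rw [hve₃]; exact sτ01m3)
    · show signVec e₃ τ02p = 1; exact sneg τ02p e₃ (by rw [hve₃]; exact sτ02p3)
    · show signVec e₃ τ02m = 1; exact sneg τ02m e₃ (by rw [hve₃]; exact sτ02m3)
    · show signVec e₃ τ11p = 1; exact sneg τ11p e₃ (by rw [hve₃]; exact sτ11p3)
    · show signVec e₃ τ11m = 1; exact sneg τ11m e₃ (by rw [hve₃]; exact sτ11m3)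
    · show signVec e₃ τ12p = 1; exact sneg τ12p e₃ (by rw [hve₃]; exact sτ12p3)
    · show signVec e₃ τ12m = 1; exact sneg τ12m e₃ (by rw [hve₃]; exact sτ12m3)
    · show signVec e₃ τ21p = 1; exact sneg τ21p e₃ (by rw [hve₃]; exact sτ21p3)
    · show signVec e₃ τ21m = 1; exact sneg τ21m e₃ (by rw [hve₃]; exact sτ21m3)
    · show signVec e₃ τ22p = 1; exact sneg τ22p e₃ (by rw [hve₃]; exact sτ22p3)
    · show signVec e₄ τ01p = 0; exact spos τ01p e₄ (by rw [hve₄]; exact sτ01p4)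
    · show signVec e₄ τ01m = 0; exact spos τ01m e₄ (by rw [hve₄]; exact sτ01m4)
    · show signVec e₄ τ02p = 1; exact sneg τ02p e₄ (by rw [hve₄]; exact sτ02p4)
    · show signVec e₄ τ02m = 1; exact sneg τ02m e₄ (by rw [hve₄]; exact sτ02m4)
    · show signVec e₄ τ11p = 0; exact spos τ11p e₄ (by rw [hve₄]; exact sτ11p4)
    · show signVec e₄ τ11m = 0; exact spos τ11m e₄ (by rw [hve₄]; exact sτ11m4)
    · show signVec e₄ τ12p = 0; exact spos τ12p e₄ (by rw [hve₄]; exact sτ12p4)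
    · show signVec e₄ τ12m = 0; exact spos τ12m e₄ (by rw [hve₄]; exact sτ12m4)
    · show signVec e₄ τ21p = 0; exact spos τ21p e₄ (by rw [hve₄]; exact sτ21p4)
    · show signVec e₄ τ21m = 0; exact spos τ21m e₄ (by rw [hve₄]; exact sτ21m4)
    · show signVec e₄ τ22p = 0; exact spos τ22p e₄ (by rw [hve₄]; exact sτ22p4)
    · show signVec e₅ τ01p = 0; exact spos τ01p e₅ (by rw [hve₅]; exact sτ01p5)
    · show signVec e₅ τ01m = 1; exact sneg τ01m e₅ (by rw [hve₅]; exact sτ01m5)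
    · show signVec e₅ τ02p = 0; exact spos τ02p e₅ (by rw [hve₅]; exact sτ02p5)
    · show signVec e₅ τ02m = 0; exact spos τ02m e₅ (by rw [hve₅]; exact sτ02m5)
    · show signVec e₅ τ11p = 0; exact spos τ11p e₅ (by rw [hve₅]; exact sτ11p5)
    · show signVec e₅ τ11m = 1; exact sneg τ11m e₅ (by rw [hve₅]; exact sτ11m5)
    · show signVec e₅ τ12p = 0; exact spos τ12p e₅ (by rw [hve₅]; exact sτ12p5)
    · show signVec e₅ τ12m = 0; exact spos τ12m e₅ (by rw [hve₅]; exact sτ12m5)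
    · show signVec e₅ τ21p = 0; exact spos τ21p e₅ (by rw [hve₅]; exact sτ21p5)
    · show signVec e₅ τ21m = 1; exact sneg τ21m e₅ (by rw [hve₅]; exact sτ21m5)
    · show signVec e₅ τ22p = 0; exact spos τ22p e₅ (by rw [hve₅]; exact sτ22p5)
    · show signVec e₆ τ01p = 0; exact spos τ01p e₆ (by rw [hve₆]; exact sτ01p6)
    · show signVec e₆ τ01m = 0; exact spos τ01m e₆ (by rw [hve₆]; exact sτ01m6)
    · show signVec e₆ τ02p = 1; exact sneg τ02p e₆ (by rw [hve₆]; exact sτ02p6)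
    · show signVec e₆ τ02m = 0; exact spos τ02m e₆ (by rw [hve₆]; exact sτ02m6)
    · show signVec e₆ τ11p = 0; exact spos τ11p e₆ (by rw [hve₆]; exact sτ11p6)
    · show signVec e₆ τ11m = 0; exact spos τ11m e₆ (by rw [hve₆]; exact sτ11m6)
    · show signVec e₆ τ12p = 1; exact sneg τ12p e₆ (by rw [hve₆]; exact sτ12p6)
    · show signVec e₆ τ12m = 0; exact spos τ12m e₆ (by rw [hve₆]; exact sτ12m6)
    · show signVec e₆ τ21p = 0; exact spos τ21p e₆ (by rw [hve₆]; exact sτ21p6)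
    · show signVec e₆ τ21m = 0; exact spos τ21m e₆ (by rw [hve₆]; exact sτ21m6)
    · show signVec e₆ τ22p = 1; exact sneg τ22p e₆ (by rw [hve₆]; exact sτ22p6)
    · show signVec e₇ τ01p = 0; exact spos τ01p e₇ (by rw [hve₇]; exact sτ01p7)
    · show signVec e₇ τ01m = 1; exact sneg τ01m e₇ (by rw [hve₇]; exact sτ01m7)
    · show signVec e₇ τ02p = 1; exact sneg τ02p e₇ (by rw [hve₇]; exact sτ02p7)
    · show signVec e₇ τ02m = 1; exact sneg τ02m e₇ (by rw [hve₇]; exact sτ02m7)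
    · show signVec e₇ τ11p = 0; exact spos τ11p e₇ (by rw [hve₇]; exact sτ11p7)
    · show signVec e₇ τ11m = 0; exact spos τ11m e₇ (by rw [hve₇]; exact sτ11m7)
    · show signVec e₇ τ12p = 0; exact spos τ12p e₇ (by rw [hve₇]; exact sτ12p7)
    · show signVec e₇ τ12m = 0; exact spos τ12m e₇ (by rw [hve₇]; exact sτ12m7)
    · show signVec e₇ τ21p = 0; exact spos τ21p e₇ (by rw [hve₇]; exact sτ21p7)
    · show signVec e₇ τ21m = 0; exact spos τ21m e₇ (by rw [hve₇]; exact sτ21m7)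
    · show signVec e₇ τ22p = 0; exact spos τ22p e₇ (by rw [hve₇]; exact sτ22p7)
    · show signVec e₈ τ01p = 1; exact sneg τ01p e₈ (by rw [hve₈]; exact sτ01p8)
    · show signVec e₈ τ01m = 0; exact spos τ01m e₈ (by rw [hve₈]; exact sτ01m8)
    · show signVec e₈ τ02p = 0; exact spos τ02p e₈ (by rw [hve₈]; exact sτ02p8)
    · show signVec e₈ τ02m = 0; exact spos τ02m e₈ (by rw [hve₈]; exact sτ02m8)
    · show signVec e₈ τ11p = 0; exact spos τ11p e₈ (by rw [hve₈]; exact sτ11p8)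
    · show signVec e₈ τ11m = 0; exact spos τ11m e₈ (by rw [hve₈]; exact sτ11m8)
    · show signVec e₈ τ12p = 0; exact spos τ12p e₈ (by rw [hve₈]; exact sτ12p8)
    · show signVec e₈ τ12m = 1; exact sneg τ12m e₈ (by rw [hve₈]; exact sτ12m8)
    · show signVec e₈ τ21p = 0; exact spos τ21p e₈ (by rw [hve₈]; exact sτ21p8)
    · show signVec e₈ τ21m = 1; exact sneg τ21m e₈ (by rw [hve₈]; exact sτ21m8)
    · show signVec e₈ τ22p = 1; exact sneg τ22p e₈ (by rw [hve₈]; exact sτ22p8)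
    · show signVec e₉ τ01p = 1; exact sneg τ01p e₉ (by rw [hve₉]; exact sτ01p9)
    · show signVec e₉ τ01m = 0; exact spos τ01m e₉ (by rw [hve₉]; exact sτ01m9)
    · show signVec e₉ τ02p = 1; exact sneg τ02p e₉ (by rw [hve₉]; exact sτ02p9)
    · show signVec e₉ τ02m = 0; exact spos τ02m e₉ (by rw [hve₉]; exact sτ02m9)
    · show signVec e₉ τ11p = 0; exact spos τ11p e₉ (by rw [hve₉]; exact sτ11p9)
    · show signVec e₉ τ11m = 0; exact spos τ11m e₉ (by rw [hve₉]; exact sτ11m9)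
    · show signVec e₉ τ12p = 0; exact spos τ12p e₉ (by rw [hve₉]; exact sτ12p9)
    · show signVec e₉ τ12m = 0; exact spos τ12m e₉ (by rw [hve₉]; exact sτ12m9)
    · show signVec e₉ τ21p = 0; exact spos τ21p e₉ (by rw [hve₉]; exact sτ21p9)
    · show signVec e₉ τ21m = 1; exact sneg τ21m e₉ (by rw [hve₉]; exact sτ21m9)
    · show signVec e₉ τ22p = 0; exact spos τ22p e₉ (by rw [hve₉]; exact sτ22p9)
    · show signVec e₁₀ τ01p = 0; exact spos τ01p e₁₀ (by rw [hve₁₀]; exact sτ01p10)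
    · show signVec e₁₀ τ01m = 1; exact sneg τ01m e₁₀ (by rw [hve₁₀]; exact sτ01m10)
    · show signVec e₁₀ τ02p = 1; exact sneg τ02p e₁₀ (by rw [hve₁₀]; exact sτ02p10)
    · show signVec e₁₀ τ02m = 0; exact spos τ02m e₁₀ (by rw [hve₁₀]; exact sτ02m10)
    · show signVec e₁₀ τ11p = 0; exact spos τ11p e₁₀ (by rw [hve₁₀]; exact sτ11p10)
    · show signVec e₁₀ τ11m = 0; exact spos τ11m e₁₀ (by rw [hve₁₀]; exact sτ11m10)
    · show signVec e₁₀ τ12p = 1; exact sneg τ12p e₁₀ (by rw [hve₁₀]; exact sτ12p10)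
    · show signVec e₁₀ τ12m = 1; exact sneg τ12m e₁₀ (by rw [hve₁₀]; exact sτ12m10)
    · show signVec e₁₀ τ21p = 0; exact spos τ21p e₁₀ (by rw [hve₁₀]; exact sτ21p10)
    · show signVec e₁₀ τ21m = 0; exact spos τ21m e₁₀ (by rw [hve₁₀]; exact sτ21m10)
    · show signVec e₁₀ τ22p = 0; exact spos τ22p e₁₀ (by rw [hve₁₀]; exact sτ22p10)
  have hdet : IsUnit (!![(1 : ZMod 2), 1, 1, 1, 1, 1, 1, 1, 1, 1, 1; 0, 0, 1, 1, 0, 0, 1, 1, 0, 0, 1; 0, 0, 1, 1, 0, 0, 0, 0, 1, 1, 1; 0, 0, 1, 1, 1, 1, 1, 1, 1, 1, 1; 0, 0, 1, 1, 0, 0, 0, 0, 0, 0, 0; 0, 1, 0, 0, 0, 1, 0, 0, 0, 1, 0; 0, 0, 1, 0, 0, 0, 1, 0, 0, 0, 1; 0, 1, 1, 1, 0, 0, 0, 0, 0, 0, 0; 1, 0, 0, 0, 0, 0, 0, 1, 0, 1, 1; 1, 0, 1, 0, 0, 0, 0, 0, 0, 1, 0; 0, 1, 1, 0, 0, 0,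 1, 1, 0, 0, 0]) := by
    have hmul : Matrix.mulᵣ (!![(1 : ZMod 2), 1, 1, 1, 1, 1, 1, 1, 1, 1, 1; 0, 0, 1, 1, 0, 0, 1, 1, 0, 0, 1; 0, 0, 1, 1, 0, 0, 0, 0, 1, 1, 1; 0, 0, 1, 1, 1, 1, 1, 1, 1, 1, 1; 0, 0, 1, 1, 0, 0, 0, 0, 0, 0, 0; 0, 1, 0, 0, 0, 1, 0, 0, 0, 1, 0; 0, 0, 1, 0, 0, 0, 1, 0, 0, 0, 1; 0, 1, 1, 1, 0, 0, 0, 0, 0, 0, 0; 1, 0, 0, 0, 0, 0, 0, 1, 0, 1, 1; 1, 0, 1, 0, 0, 0, 0, 0, 0, 1, 0; 0, 1, 1, 0, 0, 0, 1, 1, 0, 0, 0]) (!![(1 : ZMod 2), 0, 0, 1, 1, 0, 0, 1, 0, 0, 0; 0, 0, 0, 0, 1, 0, 0, 1, 0, 0, 0; 0, 0, 0, 0, 1, 0, 1, 1, 1, 1, 1; 0, 0, 0, 0, 0, 0, 1, 1, 1, 1, 1; 1, 0, 1, 0, 1, 1, 0, 1, 0, 1, 1; 1, 0, 0, 1, 1,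 1, 1, 1, 1, 0, 1; 0, 1, 0, 0, 0, 0, 1, 1, 0, 0, 1; 0, 1, 0, 0, 0, 0, 0, 1, 1, 1, 1; 1, 1, 1, 1, 0, 0, 0, 0, 0, 1, 1; 1, 0, 0, 1, 0, 0, 1, 0, 1, 0, 1; 0, 1, 0, 0, 1, 0, 1, 0, 1, 1, 0]) = 1 := by decide
    rw [Matrix.mulᵣ_eq] at hmul
    haveI := invertibleOfRightInverse _ _ hmul
    exact isUnit_of_invertible _
  have hsig := two_pow_le_card_range_signVec ![e₀, e₁, e₂, e₃, e₄, e₅, e₆, e₇, e₈, e₉, e₁₀] ![τ01p, τ01m, τ02p, τ02m, τ11p, τ11m, τ12p, τ12m, τ21p, τ21m, τ22p] _ hs hdet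
  -- the door
  have hlow : 2 ^ 1 ≤ Nat.card (TotPosUnitsModSq ↥(ℚ⟮θ⟯ ⊔ (CyclotomicZp.zpExtension 2).layer 1)) := by
    rw [pow_one]; exact two_le_card_totPosUnitsModSq_adjoin_sup_layer_one_d316 hθ
  exact index_range_pow_two_narrowClassGroup_eq_of_bounds_of_le h12 (odd_classNumber_adjoin_sup_layer_one_d316 hθ)
    (odd_classNumber_adjoin_sup_layer_two_d316 hθ) (a := 1) (b := 11) (by rw [hfin2]) hlow hsig

end Summit.BirchSwinnertonDyer.BirchSwinnertonDyer.Theorems.AddKatoTwo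

end
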